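import Mathlib.Analysis.SpecialFunctions.SmoothTransition
import Mathlib.MeasureTheory.Integral.IntervalIntegral.Periodic
import Literature.Analysis.FluidPDE.OnsagerBDSVPerturbation
import Literature.Analysis.FunctionSpaces.ContDiffHolderAlgebra
import Literature.Analysis.FunctionSpaces.SpaceTimeSliceDerivatives
import HarnessLib

/-!
# The BDSV perturbation: the squiggling cut-offs of Lemma 5.3 — discharge of F₂

Buckmaster–De Lellis–Székelyhidi–Vicol 2019, §5.2 and Lemma 5.3: smooth cut-offs `η_i(x, t)`
with (i) `0 ≤ η_i ≤ 1`, (ii) pairwise disjoint supports, (iii) `η_i = 1` on `T³ × I_i`, (iv)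
`supp η_i ⊂ T³ × (t_i - τ_q/3, t_{i+1} + τ_q/3)`, (v) `∑_i ∫ η_i² dx ≥ c₀`, and
`‖∂ₜⁿ η_i‖_m ≤ C(n, m) τ_q^{-n}`; the printed proof mollifies the indicators of the squiggling
stripes `{t_i + (τ_q/6)(sin(2πx₁) + 1/2) ≤ t ≤ t_{i+1} + (τ_q/6)(sin(2πx₁) - 1/2)}` in space and
time. This file PROVES the existence of such a family in the exact form `BDSV.CutoffFamily` of
`OnsagerBDSVPerturbation.lean` and DISCHARGES the named fact `BDSV.cutoffs_exist` (F₂ of the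
decomposition of `BDSV.perturbationStage`): `BDSV.cutoffs_exist_holds`, with `c₀ = 1/3`.

## The construction

In the rescaled time `s = (t - t_i)/τ_q` the stripes are the fixed region
`Ω̃ = {lower x ≤ s ≤ upper x}`, `lower x = 1/12 + cos(2πx₁)/6`, `upper x = 11/12 + cos(2πx₁)/6`
(we use `cos` for `sin`, a translate). Instead of mollifying `1_Ω̃` we take the explicit smooth
profile `Θ(s, x) = S((s - lower x)/δ + 1) S((upper x - s)/δ + 1)` (`BDSV.CutoffProfile.profile`)
with Mathlib's `Real.smoothTransition` `S` and `δ = 1/16`: `Θ = 1` on `Ω̃` (in particular for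
`s ∈ [1/4, 3/4] ⊃ [1/3, 2/3]`), `Θ = 0` at time-distance `≥ δ` from `Ω̃` (so `Θ(s, ·) ≠ 0` forces
`-1/3 < s < 4/3`), translates by `≥ 1` have pointwise disjoint supports (the gap between the
stripes is `1/6 > 2δ` at every `x`), and — the coverage (v) — for every `s ∈ [0,1)` the slice
`Θ(s, ·)` is `1` on a set of measure `≥ 1/3` (all of `T³` for `s ∈ [1/4,3/4]`; the slab
`{cos(2πx₁) ≤ -1/2} ⊇ {x₁ ∈ B̄(1/2, 1/6)}` for `s < 1/4`; `{cos(2πx₁) ≥ 1/2} ⊇ {x₁ ∈ B̄(0, 1/6)}`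
for `s > 3/4`; `AddCircle.volume_closedBall`). The cut-offs are
`η_i(t, x) = Θ(t/τ - i, x)` (`BDSV.CutoffProfile.cutoff`); their one-sided time derivatives within
`[0,T]` are `τ^{-n}(∂ₛⁿΘ)(t/τ - i, x)`, and the constants `C(n, m)` are uniform `C^{m,0}(T³)`
bounds of the slices of `∂ₛⁿΘ` (`BDSV.CutoffProfile.derivBound`), which exist because `∂ₛⁿΘ` is
jointly smooth and vanishes for `s ∉ [-1/3, 4/3]`.

The one new general tool proved on the way is the uniform `C^{m,0}(T^d)` bound for the slices of
a jointly smooth field over a compact time set (`BDSV.exists_forall_eContDiffHolderNorm_le`: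
continuity of the space–time iterated derivatives on `K × [0,1]^d`, lattice periodicity, and the
oscillation bound `eHolderNorm_zero_le_two_mul_eSupNorm`); the `C^{k,r}` algebra (homogeneity,
the norm of `0`) is the tree's `ContDiffHolderAlgebra.lean`.

## References

* T. Buckmaster, C. De Lellis, L. Székelyhidi Jr., V. Vicol, *Onsager's conjecture for admissible
  weak solutions*, Comm. Pure Appl. Math. 72 (2019) = arXiv:1701.08678, §5.2 (i)–(v), Lemma 5.3
  and its proof (the squiggling stripes, Fig. 2).
-/

open MeasureTheory Set
open scoped NNReal ENNReal ContDiff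

noncomputable section

namespace Literature.Analysis.FluidPDE

namespace BDSV

open FunctionSpaces FunctionSpaces.Torus

/-- The flat three-torus `T³ = (ℝ/ℤ)³`, local notation. -/
local notation "𝕋³" => UnitAddTorus (Fin 3)

/-- Euclidean `ℝ³`, local notation. -/
local notation "ℝ³" => EuclideanSpace ℝ (Fin 3)

namespace CutoffProfile

/-! ## The squiggle `cos (2π x₁)` on `T³` -/

/-- `y ↦ cos (2π y₀)` on `ℝ³` is lattice periodic. [folklore] -/
theorem isLatticePeriodic_cos : IsLatticePeriodic (fun y : ℝ³ => Real.cos (2 * Real.pi * y 0)) := by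
  intro j y
  simp only [PiLp.add_apply, PiLp.single_apply]
  split_ifs with h
  · rw [mul_add, mul_one, Real.cos_add_two_pi]
  · rw [add_zero]

/-- The smooth function `cos (2π x₁)` on `T³` (the squiggle of the BDSV cut-offs; the source uses
`sin (2π x₁)`, which is the same after a translation). [cite: BuckmasterEtAl2018, Lemma 5.3 (proof)] -/
def cosCoord : 𝕋³ → ℝ :=
  descend (fun y : ℝ³ => Real.cos (2 * Real.pi * y 0)) isLatticePeriodic_cos

/-- The lift of `cosCoord`. [folklore] -/
theorem lift_cosCoord : lift cosCoord = fun y : ℝ³ => Real.cos (2 * Real.pi * y 0) :=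
  lift_descend_holds _ _

/-- `cosCoord (proj y) = cos (2π y₀)`. [folklore] -/
theorem cosCoord_proj (y : ℝ³) : cosCoord (proj y) = Real.cos (2 * Real.pi * y 0) := by
  have h := congrFun lift_cosCoord y
  rwa [lift_apply] at h

/-- `cosCoord` is smooth. [folklore] -/
theorem isSmooth_cosCoord : IsSmooth cosCoord := by
  unfold IsSmooth
  rw [lift_cosCoord]
  exact Real.contDiff_cos.comp (contDiff_const.mul (EuclideanSpace.proj (0 : Fin 3) : ℝ³ →L[ℝ] ℝ).contDiff)

/-- `|cosCoord| ≤ 1`. [folklore] -/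
theorem abs_cosCoord_le (x : 𝕋³) : |cosCoord x| ≤ 1 := by
  obtain ⟨y, rfl⟩ := proj_surjective x
  rw [cosCoord_proj]
  exact Real.abs_cos_le_one _

/-- `cosCoord x ≤ 1`. [folklore] -/
theorem cosCoord_le (x : 𝕋³) : cosCoord x ≤ 1 := (le_abs_self _).trans (abs_cosCoord_le x)

/-- `-1 ≤ cosCoord x`. [folklore] -/
theorem neg_one_le_cosCoord (x : 𝕋³) : -1 ≤ cosCoord x := by
  have h := abs_cosCoord_le x
  rw [abs_le] at h
  exact h.1

/-! ## The profile -/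

/-- The transition width `δ = 1/16` of the profile in the time variable. [folklore] -/
def width : ℝ := 1 / 16

/-- The lower squiggling boundary `s = 1/12 + cos(2πx₁)/6` (BDSV: `t_i + (τ/6)(sin(2πx₁) + 1/2)`,
in the rescaled time `s = (t - t_i)/τ`). [cite: BuckmasterEtAl2018, Lemma 5.3 (proof)] -/
def lower (x : 𝕋³) : ℝ := 1 / 12 + cosCoord x / 6

/-- The upper squiggling boundary `s = 11/12 + cos(2πx₁)/6` (BDSV: `t_{i+1} + (τ/6)(sin(2πx₁) - 1/2)`).
[cite: BuckmasterEtAl2018, Lemma 5.3 (proof)] -/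
def upper (x : 𝕋³) : ℝ := 11 / 12 + cosCoord x / 6

/-- **The cut-off profile** `Θ(s, x) = S((s - lower x)/δ + 1) · S((upper x - s)/δ + 1)` with
Mathlib's smooth transition `S` (`0` on `(-∞,0]`, `1` on `[1,∞)`): a smooth substitute for the
mollified indicator of the squiggling region
`Ω̃ = {lower x ≤ s ≤ upper x}` of BDSV (proof of Lemma 5.3), equal to `1` on `Ω̃` and to `0` at
time-distance `≥ δ` from it. The cut-offs are `η_i(t, x) = Θ(t/τ_q - i, x)`.
[cite: BuckmasterEtAl2018, Lemma 5.3 (proof)] -/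
def profile (s : ℝ) (x : 𝕋³) : ℝ :=
  Real.smoothTransition ((s - lower x) / width + 1) * Real.smoothTransition ((upper x - s) / width + 1)

/-- `lower x ∈ [-1/12, 1/4]`. [folklore] -/
theorem lower_mem (x : 𝕋³) : lower x ∈ Icc (-1 / 12 : ℝ) (1 / 4) := by
  have h1 := cosCoord_le x; have h2 := neg_one_le_cosCoord x
  unfold lower; constructor <;> linarith

/-- `upper x ∈ [3/4, 13/12]`. [folklore] -/
theorem upper_mem (x : 𝕋³) : upper x ∈ Icc (3 / 4 : ℝ) (13 / 12) := by
  have h1 := cosCoord_le x; have h2 := neg_one_le_cosCoord x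
  unfold upper; constructor <;> linarith

/-- `upper = lower + 5/6`. [folklore] -/
theorem upper_eq (x : 𝕋³) : upper x = lower x + 5 / 6 := by unfold upper lower; ring

/-- `0 ≤ Θ`. [folklore] -/
theorem profile_nonneg (s : ℝ) (x : 𝕋³) : 0 ≤ profile s x :=
  mul_nonneg (Real.smoothTransition.nonneg _) (Real.smoothTransition.nonneg _)

/-- `Θ ≤ 1`. [folklore] -/
theorem profile_le_one (s : ℝ) (x : 𝕋³) : profile s x ≤ 1 :=
  mul_le_one₀ (Real.smoothTransition.le_one _) (Real.smoothTransition.nonneg _)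
    (Real.smoothTransition.le_one _)

/-- `Θ = 1` on the squiggling region `lower x ≤ s ≤ upper x`. [folklore] -/
theorem profile_eq_one {s : ℝ} {x : 𝕋³} (h1 : lower x ≤ s) (h2 : s ≤ upper x) : profile s x = 1 := by
  have hw : (0 : ℝ) < width := by norm_num [width]
  unfold profile
  rw [Real.smoothTransition.one_of_one_le, Real.smoothTransition.one_of_one_le, mul_one]
  · have : 0 ≤ (upper x - s) / width := div_nonneg (by linarith) hw.le
    linarith
  · have : 0 ≤ (s - lower x) / width := div_nonneg (by linarith) hw.le
    linarith

/-- `Θ(s, ·) ≡ 1` for `s ∈ [1/4, 3/4]`. [folklore] -/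
theorem profile_eq_one_of_mem {s : ℝ} (hs : s ∈ Icc (1 / 4 : ℝ) (3 / 4)) (x : 𝕋³) : profile s x = 1 :=
  profile_eq_one ((lower_mem x).2.trans hs.1) (hs.2.trans (upper_mem x).1)

/-- `Θ = 0` for `s ≤ lower x - δ`. [folklore] -/
theorem profile_eq_zero_of_le {s : ℝ} {x : 𝕋³} (h : s ≤ lower x - width) : profile s x = 0 := by
  have hw : (0 : ℝ) < width := by norm_num [width]
  unfold profile
  rw [Real.smoothTransition.zero_of_nonpos, zero_mul]
  have : (s - lower x) / width ≤ -1 := by rw [div_le_iff₀ hw]; linarith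
  linarith

/-- `Θ = 0` for `upper x + δ ≤ s`. [folklore] -/
theorem profile_eq_zero_of_ge {s : ℝ} {x : 𝕋³} (h : upper x + width ≤ s) : profile s x = 0 := by
  have hw : (0 : ℝ) < width := by norm_num [width]
  unfold profile
  rw [Real.smoothTransition.zero_of_nonpos (x := (upper x - s) / width + 1), mul_zero]
  have : (upper x - s) / width ≤ -1 := by rw [div_le_iff₀ hw]; linarith
  linarith

/-- If `Θ(s, x) ≠ 0` then `lower x - δ < s < upper x + δ`. [folklore] -/
theorem lt_of_profile_ne_zero {s : ℝ} {x : 𝕋³} (h : profile s x ≠ 0) :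
    lower x - width < s ∧ s < upper x + width :=
  ⟨lt_of_not_ge fun h' => h (profile_eq_zero_of_le h'), lt_of_not_ge fun h' => h (profile_eq_zero_of_ge h')⟩

/-- The time support of `Θ`: `Θ(s, x) ≠ 0` forces `-1/3 < s < 4/3` (indeed `-7/48 < s < 55/48`). [folklore] -/
theorem mem_Ioo_of_profile_ne_zero {s : ℝ} {x : 𝕋³} (h : profile s x ≠ 0) :
    s ∈ Ioo (-1 / 3 : ℝ) (4 / 3) := by
  obtain ⟨h1, h2⟩ := lt_of_profile_ne_zero h
  have hl := (lower_mem x).1; have hu := (upper_mem x).2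
  constructor <;> norm_num [width] at h1 h2 ⊢ <;> linarith

/-- **Disjointness of the translates**: `Θ(s, x) Θ(s', x) = 0` whenever `s' ≤ s - 1` (the gap
between the squiggling regions is `1/6 > 2δ` in time, at every `x`). [folklore] -/
theorem profile_eq_zero_or {s s' : ℝ} (h : s' ≤ s - 1) (x : 𝕋³) : profile s x = 0 ∨ profile s' x = 0 := by
  by_contra hcon
  push Not at hcon
  obtain ⟨_, h2⟩ := lt_of_profile_ne_zero hcon.1
  obtain ⟨h1, _⟩ := lt_of_profile_ne_zero hcon.2
  rw [upper_eq] at h2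
  norm_num [width] at h1 h2
  linarith

/-- `Θ` is jointly smooth on `ℝ × T³`. [folklore] -/
theorem isSmoothSpaceTimeOn_profile : IsSmoothSpaceTimeOn univ profile := by
  have hc6 : IsSmooth (fun x => cosCoord x / 6) := by
    unfold IsSmooth; exact ContDiff.div_const isSmooth_cosCoord _
  have hl : IsSmoothSpaceTimeOn univ (fun (_ : ℝ) x => lower x) :=
    isSmoothSpaceTimeOn_const ((isSmooth_const _).add hc6) _
  have hu : IsSmoothSpaceTimeOn univ (fun (_ : ℝ) x => upper x) :=
    isSmoothSpaceTimeOn_const ((isSmooth_const _).add hc6) _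
  have hs : IsSmoothSpaceTimeOn univ (fun (s : ℝ) (_ : 𝕋³) => s) :=
    contDiff_fst.contDiffOn
  have h1 : IsSmoothSpaceTimeOn univ (fun s x => Real.smoothTransition ((s - lower x) / width + 1)) :=
    Real.smoothTransition.contDiff.comp_contDiffOn (((hs.sub hl).div_const _).add
      (isSmoothSpaceTimeOn_const (isSmooth_const _) _))
  have h2 : IsSmoothSpaceTimeOn univ (fun s x => Real.smoothTransition ((upper x - s) / width + 1)) :=
    Real.smoothTransition.contDiff.comp_contDiffOn (((hu.sub hs).div_const _).add
      (isSmoothSpaceTimeOn_const (isSmooth_const _) _))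
  exact h1.mul h2


/-! ## Coverage: `Θ(r, ·) = 1` on a set of measure `≥ 1/3`, for every `r ∈ [0, 1)` -/

/-- `Θ(s, ·)` is smooth for every `s`. [folklore] -/
theorem isSmooth_profile (s : ℝ) : IsSmooth (profile s) :=
  isSmoothSpaceTimeOn_profile.isSmooth_slice (mem_univ s)

/-- `cos (2π x₁) ≥ 1/2` when `x₁` is within `1/6` of `0`. [folklore] -/
theorem half_le_cosCoord {x : 𝕋³} (hx : x 0 ∈ Metric.closedBall (0 : UnitAddCircle) (1 / 6)) :
    1 / 2 ≤ cosCoord x := by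
  obtain ⟨y, rfl⟩ := proj_surjective x
  rw [cosCoord_proj]
  rw [Metric.mem_closedBall, dist_zero_right, proj_apply, UnitAddCircle.norm_eq] at hx
  set z : ℝ := y 0 - round (y 0) with hz
  have hy : y 0 = z + round (y 0) := by rw [hz]; ring
  have h1 : Real.cos (2 * Real.pi * y 0) = Real.cos (2 * Real.pi * z) := by
    rw [hy, mul_add, show 2 * Real.pi * (round (y 0) : ℝ) = (round (y 0) : ℤ) * (2 * Real.pi) by
      ring, Real.cos_add_int_mul_two_pi]
  rw [h1, ← Real.cos_abs, ← Real.cos_pi_div_three]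
  refine Real.cos_le_cos_of_nonneg_of_le_pi (abs_nonneg _) (by linarith [Real.pi_pos]) ?_
  rw [abs_mul, abs_of_pos (by positivity : (0 : ℝ) < 2 * Real.pi)]
  nlinarith [Real.pi_pos, abs_nonneg z]

/-- `cos (2π x₁) ≤ -1/2` when `x₁` is within `1/6` of `1/2`. [folklore] -/
theorem cosCoord_le_neg_half {x : 𝕋³}
    (hx : x 0 ∈ Metric.closedBall (((1 / 2 : ℝ) : UnitAddCircle)) (1 / 6)) :
    cosCoord x ≤ -(1 / 2) := by
  obtain ⟨y, rfl⟩ := proj_surjective x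
  rw [cosCoord_proj]
  rw [Metric.mem_closedBall, dist_eq_norm, proj_apply, ← AddCircle.coe_sub, UnitAddCircle.norm_eq] at hx
  set m : ℤ := round (y 0 - 1 / 2) with hm
  set z : ℝ := y 0 - 1 / 2 - m with hz
  have hy : y 0 = z + 1 / 2 + m := by rw [hz]; ring
  have h1 : Real.cos (2 * Real.pi * y 0) = -Real.cos (2 * Real.pi * z) := by
    rw [hy, show 2 * Real.pi * (z + 1 / 2 + m) = (2 * Real.pi * z + (m : ℤ) * (2 * Real.pi)) + Real.pi by
      ring, Real.cos_add_pi, Real.cos_add_int_mul_two_pi]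
  rw [h1, neg_le_neg_iff, ← Real.cos_abs, ← Real.cos_pi_div_three]
  refine Real.cos_le_cos_of_nonneg_of_le_pi (abs_nonneg _) (by linarith [Real.pi_pos]) ?_
  rw [abs_mul, abs_of_pos (by positivity : (0 : ℝ) < 2 * Real.pi)]
  nlinarith [Real.pi_pos, abs_nonneg z]

/-- The measure of a coordinate slab `{x : T³ | x₀ ∈ B}` is the measure of `B`. [folklore] -/
theorem volume_coord_mem (B : Set UnitAddCircle) :
    volume {x : 𝕋³ | x 0 ∈ B} = volume B := by
  have h : {x : 𝕋³ | x 0 ∈ B} = Set.pi univ (fun i : Fin 3 => if i = 0 then B else univ) := by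
    ext x
    simp only [mem_setOf_eq, mem_pi, mem_univ, true_implies]
    constructor
    · intro hx i
      split_ifs with hi
      · subst hi; exact hx
      · exact mem_univ _
    · intro hx
      simpa using hx 0
  rw [h, volume_pi, Measure.pi_pi]
  simp [Fin.prod_univ_three]

/-- Closed balls of radius `1/6` in the unit circle have measure `1/3`. [folklore] -/
theorem volume_closedBall_sixth (c : UnitAddCircle) :
    volume (Metric.closedBall c (1 / 6)) = ENNReal.ofReal (1 / 3) := by
  rw [AddCircle.volume_closedBall]
  norm_num

/-- **Coverage**: for every `r ∈ [0, 1)` the profile `Θ(r, ·)` equals `1` on a set of measure at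
least `1/3` (all of `T³` for `r ∈ [1/4, 3/4]`; `{cos(2πx₁) ≤ -1/2}` for `r < 1/4`;
`{cos(2πx₁) ≥ 1/2}` for `r > 3/4`). This is property (v) of BDSV §5.2 for the single cut-off
`η_{⌊t/τ⌋}`. [cite: BuckmasterEtAl2018, §5.2 (v)] -/
theorem third_le_volume_profile_eq_one {r : ℝ} (hr : r ∈ Ico (0 : ℝ) 1) :
    ENNReal.ofReal (1 / 3) ≤ volume {x : 𝕋³ | profile r x = 1} := by
  rcases lt_or_ge r (1 / 4) with h1 | h1
  · -- `r < 1/4`: the ball around `x₁ = 1/2`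
    have hsub : {x : 𝕋³ | x 0 ∈ Metric.closedBall (((1 / 2 : ℝ) : UnitAddCircle)) (1 / 6)} ⊆
        {x : 𝕋³ | profile r x = 1} := fun x hx => by
      have hc := cosCoord_le_neg_half hx
      refine profile_eq_one ?_ ?_
      · unfold lower; linarith [hr.1]
      · linarith [(upper_mem x).1]
    calc ENNReal.ofReal (1 / 3) = volume (Metric.closedBall (((1 / 2 : ℝ) : UnitAddCircle)) (1 / 6)) :=
          (volume_closedBall_sixth _).symm
      _ = volume {x : 𝕋³ | x 0 ∈ Metric.closedBall (((1 / 2 : ℝ) : UnitAddCircle)) (1 / 6)} :=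
          (volume_coord_mem _).symm
      _ ≤ volume {x : 𝕋³ | profile r x = 1} := measure_mono hsub
  rcases le_or_gt r (3 / 4) with h2 | h2
  · -- `r ∈ [1/4, 3/4]`: everything
    have hall : {x : 𝕋³ | profile r x = 1} = univ :=
      eq_univ_of_forall fun x => profile_eq_one_of_mem ⟨h1, h2⟩ x
    rw [hall, measure_univ]
    exact ENNReal.ofReal_le_one.2 (by norm_num)
  · -- `r > 3/4`: the ball around `x₁ = 0`
    have hsub : {x : 𝕋³ | x 0 ∈ Metric.closedBall (0 : UnitAddCircle) (1 / 6)} ⊆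
        {x : 𝕋³ | profile r x = 1} := fun x hx => by
      have hc := half_le_cosCoord hx
      refine profile_eq_one ?_ ?_
      · linarith [(lower_mem x).2]
      · unfold upper; linarith [hr.2]
    calc ENNReal.ofReal (1 / 3) = volume (Metric.closedBall (0 : UnitAddCircle) (1 / 6)) :=
          (volume_closedBall_sixth _).symm
      _ = volume {x : 𝕋³ | x 0 ∈ Metric.closedBall (0 : UnitAddCircle) (1 / 6)} :=
          (volume_coord_mem _).symm
      _ ≤ volume {x : 𝕋³ | profile r x = 1} := measure_mono hsub

/-- **Coverage in integral form**: `∫ Θ(r, x)² dx ≥ 1/3` for `r ∈ [0, 1)`. [cite: BuckmasterEtAl2018, §5.2 (v)] -/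
theorem third_le_integral_profile_sq {r : ℝ} (hr : r ∈ Ico (0 : ℝ) 1) :
    (1 / 3 : ℝ) ≤ ∫ x, profile r x ^ 2 := by
  set A : Set 𝕋³ := {x | profile r x = 1} with hA
  have hAm : MeasurableSet A :=
    (isClosed_eq (isSmooth_profile r).continuous continuous_const).measurableSet
  have hind : ∀ x, A.indicator (1 : 𝕋³ → ℝ) x ≤ profile r x ^ 2 := fun x => by
    by_cases hx : x ∈ A
    · rw [indicator_of_mem hx, Pi.one_apply, show profile r x = 1 from hx, one_pow]
    · rw [indicator_of_notMem hx]; positivity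
  have hsq : IsSmooth (fun x => profile r x * profile r x) := by
    unfold IsSmooth; exact ContDiff.mul (isSmooth_profile r) (isSmooth_profile r)
  have h1 : ∫ x, A.indicator (1 : 𝕋³ → ℝ) x = volume.real A := integral_indicator_one hAm
  have h2 : (1 / 3 : ℝ) ≤ volume.real A := by
    rw [measureReal_def, ← ENNReal.ofReal_le_iff_le_toReal (measure_ne_top _ _)]
    exact third_le_volume_profile_eq_one hr
  calc (1 / 3 : ℝ) ≤ volume.real A := h2
    _ = ∫ x, A.indicator (1 : 𝕋³ → ℝ) x := h1.symm
    _ ≤ ∫ x, profile r x ^ 2 :=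
        integral_mono ((integrable_const (1 : ℝ)).indicator hAm)
          (hsq.integrable.congr (ae_of_all _ fun x => by simp [pow_two])) hind

end CutoffProfile


/-! ## Uniform `C^m` bounds for the slices of jointly smooth fields; homogeneity -/

section UniformBounds

variable {d : Type*} [Fintype d] {F : Type*} [NormedAddCommGroup F] [NormedSpace ℝ F]

/-- Lattice periodicity of the space–time iterated derivatives of a lift. [folklore] -/
theorem iteratedFDeriv_stLift_add_latticeVec [DecidableEq d] {u : ℝ → UnitAddTorus d → F} (j : ℕ) (s : ℝ)
    (y : EuclideanSpace ℝ d) (k : d → ℤ) :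
    iteratedFDeriv ℝ j (stLift u) (s, y + latticeVec k) = iteratedFDeriv ℝ j (stLift u) (s, y) := by
  have hper : (fun z : ℝ × EuclideanSpace ℝ d => stLift u (z + (0, latticeVec k))) = stLift u := by
    funext z
    obtain ⟨t, w⟩ := z
    simp [stLift]
  have h := iteratedFDeriv_comp_add_right (𝕜 := ℝ) (f := stLift u) j ((0 : ℝ), latticeVec k) (s, y)
  rw [hper] at h
  rw [h]
  simp

/-- **Uniform `C^m` bounds on compact time sets.** For a field `u` jointly smooth on `ℝ × T^d` and
a compact set `K` of times, the `C^{m,0}(T^d)` norms of the slices `u(s, ·)`, `s ∈ K`, are bounded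
(continuity of the space–time iterated derivatives on the compact `K × [0,1]^d`, periodicity, and
oscillation `≤ 2 sup` for the `0`-Hölder seminorm). [folklore] -/
theorem exists_forall_eContDiffHolderNorm_le [DecidableEq d] {u : ℝ → UnitAddTorus d → F}
    (hu : IsSmoothSpaceTimeOn univ u) {K : Set ℝ} (hK : IsCompact K) (m : ℕ) :
    ∃ B : ℝ, 0 ≤ B ∧ ∀ s ∈ K, Torus.eContDiffHolderNorm m 0 (u s) ≤ ENNReal.ofReal B := by
  have hF : ContDiff ℝ ∞ (stLift u) := by
    have h := hu
    rw [IsSmoothSpaceTimeOn, univ_prod_univ] at h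
    exact contDiffOn_univ.1 h
  -- bounds for each order on the compact `K × cube`, extended by periodicity
  have hbound : ∀ j : ℕ, ∃ C : ℝ, 0 ≤ C ∧ ∀ s ∈ K, ∀ y : EuclideanSpace ℝ d,
      ‖iteratedFDeriv ℝ j (stLift u) (s, y)‖ ≤ C := by
    intro j
    have hc : Continuous (iteratedFDeriv ℝ j (stLift u)) :=
      hF.continuous_iteratedFDeriv (by exact_mod_cast le_top)
    obtain ⟨C, hC⟩ := (hK.prod (isCompact_toLp_image_pi_Icc (d := d))).exists_bound_of_continuousOn
      hc.continuousOn
    refine ⟨max C 0, le_max_right _ _, fun s hs y => ?_⟩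
    obtain ⟨k, hk⟩ := exists_repr_proj_eq_add_latticeVec_holds y
    have h1 := hC (s, repr (proj y)) (mk_mem_prod hs (repr_mem_toLp_image_pi_Icc _))
    rw [hk, iteratedFDeriv_stLift_add_latticeVec] at h1
    exact h1.trans (le_max_left _ _)
  choose C hC0 hC using hbound
  have hsum0 : 0 ≤ ∑ j ∈ Finset.range (m + 1), C j := Finset.sum_nonneg fun j _ => hC0 j
  have hm0 : 0 ≤ 2 * C m := mul_nonneg zero_le_two (hC0 m)
  refine ⟨(∑ j ∈ Finset.range (m + 1), C j) + 2 * C m, add_nonneg hsum0 hm0, fun s hs => ?_⟩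
  have hsup : ∀ j, eSupNorm (iteratedFDeriv ℝ j (lift (u s))) ≤ ENNReal.ofReal (C j) := fun j =>
    iSup_le fun y => by
      rw [← ofReal_norm]
      exact ENNReal.ofReal_le_ofReal ((norm_iteratedFDeriv_slice_le (n := j)
        (hF.of_le (by exact_mod_cast le_top)) s le_rfl y).trans (hC j s hs y))
  have hhol : eHolderNorm 0 (iteratedFDeriv ℝ m (lift (u s))) ≤ ENNReal.ofReal (2 * C m) := by
    refine (eHolderNorm_zero_le_two_mul_eSupNorm _).trans ?_
    rw [ENNReal.ofReal_mul zero_le_two, ENNReal.ofReal_ofNat]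
    exact mul_le_mul_right (hsup m) 2
  unfold Torus.eContDiffHolderNorm FunctionSpaces.eContDiffHolderNorm
  rw [ENNReal.ofReal_add hsum0 hm0, ENNReal.ofReal_sum_of_nonneg (fun j _ => hC0 j)]
  exact add_le_add (Finset.sum_le_sum fun j _ => hsup j) hhol

end UniformBounds

namespace CutoffProfile

/-! ## The time derivatives of the profile and their uniform bounds -/

/-- The `n`-th time derivative `∂ₛⁿ Θ` of the profile (iterated global time derivative). [folklore] -/
def profileDeriv (n : ℕ) : ℝ → 𝕋³ → ℝ := (timeDerivWithin univ)^[n] profile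

/-- `∂ₛ^{n+1} Θ = ∂ₛ (∂ₛⁿ Θ)`. [folklore] -/
theorem profileDeriv_succ (n : ℕ) : profileDeriv (n + 1) = timeDerivWithin univ (profileDeriv n) :=
  Function.iterate_succ_apply' _ _ _

/-- The time derivatives of the profile are jointly smooth. [folklore] -/
theorem isSmoothSpaceTimeOn_profileDeriv (n : ℕ) : IsSmoothSpaceTimeOn univ (profileDeriv n) := by
  induction n with
  | zero => exact isSmoothSpaceTimeOn_profile
  | succ n ih => rw [profileDeriv_succ]; exact ih.timeDerivWithin uniqueDiffOn_univ

/-- Pointwise differentiability of `s ↦ ∂ₛⁿΘ(s, x)`, with derivative `∂ₛ^{n+1}Θ(s, x)`. [folklore] -/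
theorem hasDerivAt_profileDeriv (n : ℕ) (s : ℝ) (x : 𝕋³) :
    HasDerivAt (fun s' => profileDeriv n s' x) (profileDeriv (n + 1) s x) s := by
  rw [profileDeriv_succ]
  exact ((isSmoothSpaceTimeOn_profileDeriv n).hasDerivWithinAt_slice (mem_univ s) x).hasDerivAt
    Filter.univ_mem

/-- All time derivatives of the profile vanish before time `-1/3`. [folklore] -/
theorem profileDeriv_eq_zero_of_lt (n : ℕ) {s : ℝ} (hs : s < -1 / 3) (x : 𝕋³) : profileDeriv n s x = 0 := by
  induction n generalizing s with
  | zero =>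
    show profile s x = 0
    by_contra h
    exact absurd (mem_Ioo_of_profile_ne_zero h).1 (not_lt.2 hs.le)
  | succ n ih =>
    have hev : (fun s' => profileDeriv n s' x) =ᶠ[nhds s] fun _ => (0 : ℝ) :=
      Filter.eventually_of_mem (Iio_mem_nhds hs) fun s' hs' => ih hs'
    rw [← (hasDerivAt_profileDeriv n s x).deriv, hev.deriv_eq, deriv_const]

/-- All time derivatives of the profile vanish after time `4/3`. [folklore] -/
theorem profileDeriv_eq_zero_of_gt (n : ℕ) {s : ℝ} (hs : 4 / 3 < s) (x : 𝕋³) : profileDeriv n s x = 0 := by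
  induction n generalizing s with
  | zero =>
    show profile s x = 0
    by_contra h
    exact absurd (mem_Ioo_of_profile_ne_zero h).2 (not_lt.2 hs.le)
  | succ n ih =>
    have hev : (fun s' => profileDeriv n s' x) =ᶠ[nhds s] fun _ => (0 : ℝ) :=
      Filter.eventually_of_mem (Ioi_mem_nhds hs) fun s' hs' => ih hs'
    rw [← (hasDerivAt_profileDeriv n s x).deriv, hev.deriv_eq, deriv_const]

/-- **Uniform `C^m` bounds for the time derivatives of the profile** (the geometric constants
`C(n, m)` of Lemma 5.3): `‖∂ₛⁿ Θ(s, ·)‖_{C^{m,0}} ≤ B(n, m)` for all `s ∈ ℝ`. [cite: BuckmasterEtAl2018, Lemma 5.3] -/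
theorem exists_bound_profileDeriv (n m : ℕ) :
    ∃ B : ℝ, 0 ≤ B ∧ ∀ s : ℝ, Torus.eContDiffHolderNorm m 0 (profileDeriv n s) ≤ ENNReal.ofReal B := by
  obtain ⟨B, hB0, hB⟩ := exists_forall_eContDiffHolderNorm_le (isSmoothSpaceTimeOn_profileDeriv n)
    (isCompact_Icc (a := (-1 / 3 : ℝ)) (b := 4 / 3)) m
  refine ⟨B, hB0, fun s => ?_⟩
  by_cases hs : s ∈ Icc (-1 / 3 : ℝ) (4 / 3)
  · exact hB s hs
  · have hz : profileDeriv n s = fun _ => (0 : ℝ) := by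
      funext x
      rcases lt_or_ge s (-1 / 3) with h | h
      · exact profileDeriv_eq_zero_of_lt n h x
      · have h4 : 4 / 3 < s := lt_of_not_ge fun h4 => hs ⟨h, h4⟩
        exact profileDeriv_eq_zero_of_gt n h4 x
    rw [hz, show (fun _ : 𝕋³ => (0 : ℝ)) = 0 from rfl, Torus.eContDiffHolderNorm_zero_fun]
    exact bot_le

/-- The geometric constants `C(n, m)` of Lemma 5.3 for the profile `Θ`. [cite: BuckmasterEtAl2018, Lemma 5.3] -/
def derivBound (n m : ℕ) : ℝ := Classical.choose (exists_bound_profileDeriv n m)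

/-- `0 ≤ C(n, m)`. [folklore] -/
theorem derivBound_nonneg (n m : ℕ) : 0 ≤ derivBound n m :=
  (Classical.choose_spec (exists_bound_profileDeriv n m)).1

/-- `‖∂ₛⁿ Θ(s, ·)‖_{C^{m,0}} ≤ C(n, m)`. [folklore] -/
theorem eContDiffHolderNorm_profileDeriv_le (n m : ℕ) (s : ℝ) :
    Torus.eContDiffHolderNorm m 0 (profileDeriv n s) ≤ ENNReal.ofReal (derivBound n m) :=
  (Classical.choose_spec (exists_bound_profileDeriv n m)).2 s

/-! ## The cut-offs `η_i(t, x) = Θ(t/τ - i, x)` -/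

/-- **The BDSV cut-offs** `η_i(t, x) = Θ(t/τ - i, x)`, `i ∈ ℕ` (Lemma 5.3: the mollified
indicators of the squiggling stripes, here the profile `Θ` transported to the windows
`(t_i - τ/3, t_{i+1} + τ/3)`, `t_i = iτ`). [cite: BuckmasterEtAl2018, Lemma 5.3] -/
def cutoff (τ : ℝ) (i : ℕ) (t : ℝ) (x : 𝕋³) : ℝ := profile (t / τ - i) x

/-- The cut-offs are jointly smooth (on any time set). [folklore] -/
theorem isSmoothSpaceTimeOn_cutoff (τ : ℝ) (i : ℕ) (S : Set ℝ) : IsSmoothSpaceTimeOn S (cutoff τ i) := by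
  have hF : ContDiff ℝ ∞ (stLift profile) := by
    have h := isSmoothSpaceTimeOn_profile
    rw [IsSmoothSpaceTimeOn, univ_prod_univ] at h
    exact contDiffOn_univ.1 h
  have h : stLift (cutoff τ i) = stLift profile ∘ fun p : ℝ × ℝ³ => (p.1 / τ - i, p.2) := by
    funext p; rfl
  unfold IsSmoothSpaceTimeOn
  rw [h]
  exact (hF.comp ((contDiff_fst.div_const _ |>.sub contDiff_const).prodMk contDiff_snd)).contDiffOn

/-- **The time derivatives of the cut-offs within `[0,T]`**: for `T, τ > 0`,
`∂ₜⁿ η_i(t, x) = τ^{-n} (∂ₛⁿΘ)(t/τ - i, x)` for `t ∈ [0,T]` (one-sided derivatives within `[0,T]`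
agree with the derivatives of the globally smooth `η_i`; chain rule). [folklore] -/
theorem iterate_timeDerivWithin_cutoff {T τ : ℝ} (hT : 0 < T) (hτ : 0 < τ) (i n : ℕ) :
    ∀ t ∈ Icc 0 T, ∀ x : 𝕋³, ((timeDerivWithin (Icc 0 T))^[n] (cutoff τ i)) t x =
      (τ ^ n)⁻¹ * profileDeriv n (t / τ - i) x := by
  induction n with
  | zero => intro t _ x; simp [cutoff, profileDeriv]
  | succ n ih =>
    intro t ht x
    rw [Function.iterate_succ_apply']
    show derivWithin (fun t' => ((timeDerivWithin (Icc 0 T))^[n] (cutoff τ i)) t' x) (Icc 0 T) t = _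
    have hG : HasDerivAt (fun t' : ℝ => (τ ^ n)⁻¹ * profileDeriv n (t' / τ - i) x)
        ((τ ^ n)⁻¹ * (profileDeriv (n + 1) (t / τ - i) x * τ⁻¹)) t := by
      refine HasDerivAt.const_mul _ ?_
      have h1 : HasDerivAt (fun t' : ℝ => t' / τ - i) τ⁻¹ t := by
        simpa using ((hasDerivAt_id t).div_const τ).sub_const (i : ℝ)
      exact (hasDerivAt_profileDeriv n (t / τ - i) x).comp t h1
    rw [derivWithin_congr (fun t' ht' => ih t' ht' x) (ih t ht x),
      hG.hasDerivWithinAt.derivWithin (uniqueDiffOn_Icc hT t ht)]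
    rw [pow_succ]
    field_simp

/-- **Lemma 5.3 bounds**: `‖∂ₜⁿ η_i‖_m ≤ C(n,m) τ^{-n}` on `[0,T]`. [cite: BuckmasterEtAl2018, Lemma 5.3] -/
theorem holderSupLE_cutoff {T τ : ℝ} (hT : 0 < T) (hτ : 0 < τ) (i n m : ℕ) :
    HolderSupLE T ((timeDerivWithin (Icc 0 T))^[n] (cutoff τ i)) m 0 (derivBound n m * τ ^ (-(n : ℝ))) := by
  intro t ht
  have hslice : ((timeDerivWithin (Icc 0 T))^[n] (cutoff τ i)) t =
      (τ ^ n)⁻¹ • profileDeriv n (t / τ - i) := by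
    funext x
    rw [iterate_timeDerivWithin_cutoff hT hτ i n t ht x, Pi.smul_apply, smul_eq_mul]
  rw [hslice, Torus.eContDiffHolderNorm_const_smul
    (((isSmoothSpaceTimeOn_profileDeriv n).isSmooth_slice (mem_univ _)).isContDiff (by exact_mod_cast le_top))]
  have hτn : 0 < (τ ^ n)⁻¹ := by positivity
  calc ‖(τ ^ n)⁻¹‖ₑ * Torus.eContDiffHolderNorm m 0 (profileDeriv n (t / τ - i))
      ≤ ENNReal.ofReal ((τ ^ n)⁻¹) * ENNReal.ofReal (derivBound n m) := by
        rw [Real.enorm_eq_ofReal hτn.le]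
        exact mul_le_mul_right (eContDiffHolderNorm_profileDeriv_le n m _) _
    _ = ENNReal.ofReal (derivBound n m * τ ^ (-(n : ℝ))) := by
        rw [← ENNReal.ofReal_mul hτn.le, Real.rpow_neg hτ.le, Real.rpow_natCast, mul_comm]

end CutoffProfile

/-! ## Discharge of F₂: `BDSV.cutoffs_exist` -/

section Discharge

open CutoffProfile

/-- **The cut-off family of Lemma 5.3** for the horizon `T > 0` and scale `τ > 0`, with the
geometric constants `c₀ = 1/3` and `C(n, m) = CutoffProfile.derivBound n m`.
[cite: BuckmasterEtAl2018, Lemma 5.3] -/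
def cutoffFamily {T τ : ℝ} (hT : 0 < T) (hτ : 0 < τ) : CutoffFamily T τ (1 / 3) derivBound where
  η := cutoff τ
  smooth i := isSmoothSpaceTimeOn_cutoff τ i _
  nonneg _ _ _ := profile_nonneg _ _
  le_one _ _ _ := profile_le_one _ _
  disjoint i j hij t x := by
    rcases lt_or_gt_of_ne hij with h | h
    · have hle : t / τ - j ≤ t / τ - i - 1 := by
        have : (i : ℝ) + 1 ≤ j := by exact_mod_cast h
        linarith
      exact profile_eq_zero_or hle x
    · have hle : t / τ - i ≤ t / τ - j - 1 := by
        have : (j : ℝ) + 1 ≤ i := by exact_mod_cast h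
        linarith
      exact (profile_eq_zero_or hle x).symm
  eq_one i t _ hI x := by
    refine profile_eq_one_of_mem ⟨?_, ?_⟩ x
    · have h1 : ((i : ℝ) * τ + τ / 3) / τ ≤ t / τ := div_le_div_of_nonneg_right hI.1 hτ.le
      rw [show ((i : ℝ) * τ + τ / 3) / τ = i + 1 / 3 by field_simp] at h1
      linarith
    · have h1 : t / τ ≤ ((i : ℝ) * τ + 2 * τ / 3) / τ := div_le_div_of_nonneg_right hI.2 hτ.le
      rw [show ((i : ℝ) * τ + 2 * τ / 3) / τ = i + 2 / 3 by field_simp] at h1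
      linarith
  support i t x h := by
    obtain ⟨h1, h2⟩ := mem_Ioo_of_profile_ne_zero h
    constructor
    · have h3 : (i : ℝ) - 1 / 3 < t / τ := by linarith
      have := (lt_div_iff₀ hτ).1 h3
      linarith
    · have h3 : t / τ < (i : ℝ) + 4 / 3 := by linarith
      have := (div_lt_iff₀ hτ).1 h3
      linarith
  sum_sq_ge t ht := by
    set i₀ : ℕ := ⌊t / τ⌋₊ with hi₀
    have ht0 : 0 ≤ t / τ := div_nonneg ht.1 hτ.le
    have hr : t / τ - i₀ ∈ Ico (0 : ℝ) 1 :=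
      ⟨sub_nonneg.2 (Nat.floor_le ht0), by have := Nat.lt_floor_add_one (t / τ); linarith⟩
    have hmem : i₀ ∈ Finset.range (cutoffCount T τ) := by
      rw [Finset.mem_range, cutoffCount]
      have h1 : (i₀ : ℝ) ≤ t / τ := Nat.floor_le ht0
      have h2 : t / τ ≤ T / τ := div_le_div_of_nonneg_right ht.2 hτ.le
      have h3 : T / τ ≤ ⌈T / τ⌉₊ := Nat.le_ceil _
      have h4 : (i₀ : ℝ) < ⌈T / τ⌉₊ + 2 := by linarith
      exact_mod_cast h4
    have hterm : (1 / 3 : ℝ) ≤ ∫ x, cutoff τ i₀ t x ^ 2 := third_le_integral_profile_sq hr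
    refine hterm.trans ?_
    exact Finset.single_le_sum (f := fun i => ∫ x, cutoff τ i t x ^ 2)
      (fun i _ => integral_nonneg fun x => sq_nonneg _) hmem
  deriv_le i n m := holderSupLE_cutoff hT hτ i n m

/-- **Discharge of F₂** (`BDSV.cutoffs_exist`, BDSV Lemma 5.3 with §5.2 (i)–(v)): squiggling
cut-offs exist for every horizon `T > 0` and scale `τ > 0`, with the geometric constants
`c₀ = 1/3` and `C(n, m) = CutoffProfile.derivBound n m` (independent of `T, τ`).
[cite: BuckmasterEtAl2018, Lemma 5.3] -/
theorem cutoffs_exist_holds : cutoffs_exist :=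
  ⟨1 / 3, by norm_num, derivBound, fun _ _ hT hτ => ⟨cutoffFamily hT hτ⟩⟩

end Discharge

end BDSV

end Literature.Analysis.FluidPDE
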